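import Literature.AlgebraicGeometry.Resolution.ProjectiveModelsFunctionField
import Literature.AlgebraicGeometry.Resolution.ProjectiveModelsDomination
import Literature.AlgebraicGeometry.Resolution.QuadraticTransforms
import Mathlib.RingTheory.Valuation.LocalSubring
import HarnessLib

/-!
# Local rings of projective models inside `K`, and centres of local rings

Topic: `Literature/AlgebraicGeometry/Resolution`. Zariski–Samuel II, Ch. VI §17 ("if `P` is a
point of a model `V` of `K/k`, the local ring `𝒪_P(V)` is a subring of `K` … a local ring `𝔬`
of `K` has a centre on `V` if it dominates the local ring of some point of `V`; the centre is
unique") for the projective models `ProjModel k K` of `ProjectiveModels.lean`: the local rings of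
the points of a model are realised INSIDE the fixed field `K` (through `K(M) ≅ K`,
`ProjectiveModelsFunctionField.lean`), so that the birational dictionary of Piltant 2013, §3 and
of the quadratic-transform theory (`QuadraticTransforms.lean`, subrings of `K`) can be applied to
them. All PROVED:

* `ProjModel.stalkToK M x : 𝒪_{M,x} → K` (injective), `ProjModel.stalkSubring M x ⊆ K` its image
  (a local ring of `K`: `isLocalRingOf_stalkSubring`), `specMap_stalkToK_fromSpecStalk`
  (`Spec K → Spec 𝒪_{M,x} → M` is `gen_M`);
* functoriality: along a morphism of models `φ : N → M`, `𝒪_{M,φ y} ⊆ 𝒪_{N,y}` is dominated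
  (`stalkSubring_dominates_of_hom`), with equality when `φ` is a local isomorphism at `y`;
* `ProjModel.IsCentreOf M 𝔬 x` — the local ring `𝔬 ⊆ K` dominates `𝒪_{M,x}` — and its
  equivalence with the morphism form "`Spec 𝔬 → M` through `x` restricting to `gen_M` on
  `Spec K`" (`IsCentreOf.exists_lift`, `isCentreOf_of_lift`); uniqueness of the centre
  (`IsCentreOf.unique`, via a valuation ring dominating `𝔬` and the valuative criterion of
  separatedness); existence for valuation rings (`isCentreOf_centre`); functoriality and
  invariance under local isomorphisms; centres on the join `J(M₁, M₂)` of two models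
  (`exists_isCentreOf_join`: a local ring with centres on `M₁` and on `M₂` has one on the join).

## References

* O. Zariski, P. Samuel, *Commutative Algebra* II (1960), Ch. VI §17. [ZariskiSamuel1960]
* O. Piltant, RACSAM 107 (2013), §3 (birational correspondences, Lemma 3.3). [Piltant2013]
-/

noncomputable section

open CategoryTheory CategoryTheory.Limits AlgebraicGeometry TopologicalSpace IsLocalRing
open Literature.AlgebraicGeometry.Motives

universe u

namespace Literature.AlgebraicGeometry.Resolution

namespace ProjModel

variable {k K : Type u} [Field k] [Field K] [Algebra k K]

/-! ## `𝒪_{M,x} ⊆ K` -/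

/-- **`𝒪_{M,x} → K`**: the local ring of a point of a projective model of `K/k` inside `K`
(`𝒪_{M,x} → K(M) ≅ K`). [cite: ZariskiSamuel1960, Ch. VI §17] -/
def stalkToK (M : ProjModel k K) (x : M.X) : M.X.presheaf.stalk x →+* K :=
  M.funFieldIso.hom.hom.comp (RatFn.toFunctionField x)

/-- `𝒪_{M,x} → K` as a morphism of `CommRingCat`. [folklore] -/
theorem ofHom_stalkToK (M : ProjModel k K) (x : M.X) :
    CommRingCat.ofHom (M.stalkToK x) =
      M.X.presheaf.stalkSpecializes ((genericPoint_spec M.X).specializes trivial) ≫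
        M.funFieldIso.hom := rfl

/-- `𝒪_{M,x} → K` is injective. [cite: ZariskiSamuel1960, Ch. VI §17] -/
theorem stalkToK_injective (M : ProjModel k K) (x : M.X) : Function.Injective (M.stalkToK x) :=
  M.funFieldIso.commRingCatIsoToRingEquiv.injective.comp (RatFn.toFunctionField_injective x)

/-- **`Spec K → Spec 𝒪_{M,x} → M` is the `K`-point `gen_M`.** [cite: ZariskiSamuel1960, Ch. VI §17] -/
@[reassoc]
theorem specMap_stalkToK_fromSpecStalk (M : ProjModel k K) (x : M.X) :
    Spec.map (CommRingCat.ofHom (M.stalkToK x)) ≫ M.X.fromSpecStalk x = M.gen := by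
  rw [ofHom_stalkToK, Spec.map_comp, Category.assoc, Scheme.SpecMap_stalkSpecializes_fromSpecStalk,
    specMap_funFieldIso_hom_fromSpecStalk]

/-- **The local ring `𝒪_{M,x}` as a local subring of `K`.** [cite: ZariskiSamuel1960, Ch. VI §17] -/
def stalkLocalSubring (M : ProjModel k K) (x : M.X) : LocalSubring K :=
  LocalSubring.range (M.stalkToK x)

/-- **The local ring `𝒪_{M,x}` as a subring of `K`.** [cite: ZariskiSamuel1960, Ch. VI §17] -/
abbrev stalkSubring (M : ProjModel k K) (x : M.X) : Subring K :=
  (M.stalkLocalSubring x).toSubring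

/-- Unfolding: `stalkSubring M x` is the range of `stalkToK`. [folklore] -/
theorem stalkSubring_eq_range (M : ProjModel k K) (x : M.X) :
    M.stalkSubring x = (M.stalkToK x).range := by
  change (LocalSubring.range (M.stalkToK x)).toSubring = _
  rw [LocalSubring.range_toSubring, Subring.copy_eq, ← RingHom.range_eq_map]

/-- Membership in `stalkSubring`. [folklore] -/
theorem mem_stalkSubring_iff (M : ProjModel k K) (x : M.X) {z : K} :
    z ∈ M.stalkSubring x ↔ ∃ t, M.stalkToK x t = z := by
  rw [stalkSubring_eq_range, RingHom.mem_range]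

/-- `stalkToK x t ∈ stalkSubring M x`. [folklore] -/
theorem stalkToK_mem (M : ProjModel k K) (x : M.X) (t : M.X.presheaf.stalk x) :
    M.stalkToK x t ∈ M.stalkSubring x :=
  (M.mem_stalkSubring_iff x).mpr ⟨t, rfl⟩

/-- `𝒪_{M,x} → K` with values in `stalkSubring M x`. [folklore] -/
def stalkToSubring (M : ProjModel k K) (x : M.X) : M.X.presheaf.stalk x →+* M.stalkSubring x :=
  (M.stalkToK x).codRestrict _ (M.stalkToK_mem x)

/-- Unfolding. [folklore] -/
@[simp] theorem coe_stalkToSubring (M : ProjModel k K) (x : M.X) (t : M.X.presheaf.stalk x) :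
    (M.stalkToSubring x t : K) = M.stalkToK x t := rfl

/-- `stalkToSubring` is bijective. [folklore] -/
theorem stalkToSubring_bijective (M : ProjModel k K) (x : M.X) :
    Function.Bijective (M.stalkToSubring x) := by
  refine ⟨fun a b h => M.stalkToK_injective x (congrArg Subtype.val h), fun z => ?_⟩
  obtain ⟨t, ht⟩ := (M.mem_stalkSubring_iff x).mp z.2
  exact ⟨t, Subtype.ext ht⟩

/-- **`𝒪_{M,x} ≅ stalkSubring M x`.** [cite: ZariskiSamuel1960, Ch. VI §17] -/
def stalkEquiv (M : ProjModel k K) (x : M.X) : M.X.presheaf.stalk x ≃+* M.stalkSubring x :=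
  RingEquiv.ofBijective (M.stalkToSubring x) (M.stalkToSubring_bijective x)

/-- Unfolding. [folklore] -/
@[simp] theorem coe_stalkEquiv (M : ProjModel k K) (x : M.X) (t : M.X.presheaf.stalk x) :
    ((M.stalkEquiv x t : M.stalkSubring x) : K) = M.stalkToK x t := rfl

/-- `(stalkEquiv).symm z ↦ z` under `stalkToK`. [folklore] -/
@[simp] theorem stalkToK_stalkEquiv_symm (M : ProjModel k K) (x : M.X) (z : M.stalkSubring x) :
    M.stalkToK x ((M.stalkEquiv x).symm z) = z := by
  have h : ((M.stalkEquiv x ((M.stalkEquiv x).symm z) : M.stalkSubring x) : K) = z := by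
    rw [(M.stalkEquiv x).apply_symm_apply]
  exact h

/-- `stalkSubring M x` is a local ring. [folklore] -/
instance isLocalRing_stalkSubring (M : ProjModel k K) (x : M.X) :
    IsLocalRing (M.stalkSubring x) :=
  (M.stalkLocalSubring x).isLocalRing

/-- An element of `stalkSubring` is a unit iff its preimage in `𝒪_{M,x}` is. [folklore] -/
theorem isUnit_stalkEquiv_iff (M : ProjModel k K) (x : M.X) (t : M.X.presheaf.stalk x) :
    IsUnit (M.stalkEquiv x t) ↔ IsUnit t :=
  ⟨fun h => by simpa using h.map (M.stalkEquiv x).symm, fun h => h.map _⟩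

/-- **`stalkSubring M x` is a local ring OF `K`** (its quotient field is `K`): `K = Frac 𝒪_{M,x}`.
[cite: ZariskiSamuel1960, Ch. VI §17] -/
theorem isLocalRingOf_stalkSubring (M : ProjModel k K) (x : M.X) :
    IsLocalRingOf (M.stalkSubring x) := by
  refine ⟨inferInstance, fun z => ?_⟩
  let e : M.X.functionField ≃+* K := M.funFieldIso.commRingCatIsoToRingEquiv
  obtain ⟨a, b, hb, hab⟩ := IsFractionRing.div_surjective (A := M.X.presheaf.stalk x) (e.symm z)
  refine ⟨M.stalkToK x a, M.stalkToK_mem x a, M.stalkToK x b, M.stalkToK_mem x b, ?_, ?_⟩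
  · exact (map_ne_zero_iff _ (M.stalkToK_injective x)).mpr (nonZeroDivisors.ne_zero hb)
  · have h : e (e.symm z) = z := e.apply_symm_apply z
    rw [← hab, map_div₀] at h
    exact h.symm

/-- The `k`-algebra structure on `K(M)` of `ProjectiveModelsFunctionField` (transported from
`K`) is the geometric one `k = Γ(Spec k) → Γ(M, 𝒪) → K(M)`: both induce `Spec K(M) → M → Spec k`.
[folklore] -/
theorem algebraMap_functionField_eq_germ (M : ProjModel k K) :
    algebraMap k M.X.functionField =
      (M.X.presheaf.germ ⊤ (genericPoint M.X) trivial).hom.comp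
        (M.π.appTop.hom.comp (Scheme.ΓSpecIso (.of k)).inv.hom) := by
  set ψ₀ : k →+* M.X.functionField := (M.X.presheaf.germ ⊤ (genericPoint M.X) trivial).hom.comp
    (M.π.appTop.hom.comp (Scheme.ΓSpecIso (.of k)).inv.hom) with hψ₀
  have e1 : (Spec (CommRingCat.of k)).toSpecΓ ≫ Spec.map (Scheme.ΓSpecIso (.of k)).inv = 𝟙 _ := by
    rw [← SpecMap_ΓSpecIso_hom, ← Spec.map_comp, Iso.inv_hom_id, Spec.map_id]
  have h1 : Spec.map (CommRingCat.ofHom ψ₀) = M.X.fromSpecStalk (genericPoint M.X) ≫ M.π := by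
    calc Spec.map (CommRingCat.ofHom ψ₀)
        = Spec.map (M.X.presheaf.germ ⊤ (genericPoint M.X) trivial) ≫ Spec.map M.π.appTop ≫
            Spec.map (Scheme.ΓSpecIso (.of k)).inv := by
          rw [hψ₀, show CommRingCat.ofHom ((M.X.presheaf.germ ⊤ (genericPoint M.X) trivial).hom.comp
              (M.π.appTop.hom.comp (Scheme.ΓSpecIso (.of k)).inv.hom)) =
            (Scheme.ΓSpecIso (.of k)).inv ≫ M.π.appTop ≫
              M.X.presheaf.germ ⊤ (genericPoint M.X) trivial from rfl,
            Spec.map_comp, Spec.map_comp, Category.assoc]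
      _ = M.X.fromSpecStalk (genericPoint M.X) ≫ M.X.toSpecΓ ≫ Spec.map M.π.appTop ≫
            Spec.map (Scheme.ΓSpecIso (.of k)).inv := by rw [Scheme.fromSpecStalk_toSpecΓ_assoc]
      _ = M.X.fromSpecStalk (genericPoint M.X) ≫ M.π ≫ (Spec (CommRingCat.of k)).toSpecΓ ≫
            Spec.map (Scheme.ΓSpecIso (.of k)).inv := by rw [Scheme.toSpecΓ_naturality_assoc M.π]
      _ = M.X.fromSpecStalk (genericPoint M.X) ≫ M.π := by rw [e1, Category.comp_id]
  rw [M.fromSpecStalk_genericPoint_π] at h1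
  have h2 := Spec.map_injective h1
  exact (congrArg CommRingCat.Hom.hom h2).symm

/-- The structure field `k` lies in every `stalkSubring`. [folklore] -/
theorem algebraMap_mem_stalkSubring (M : ProjModel k K) (x : M.X) (c : k) :
    algebraMap k K c ∈ M.stalkSubring x := by
  rw [M.mem_stalkSubring_iff x]
  refine ⟨M.X.presheaf.germ ⊤ x trivial (M.π.appTop ((Scheme.ΓSpecIso (.of k)).inv c)), ?_⟩
  rw [← M.funFieldIso_hom_algebraMap c]
  change M.funFieldIso.hom.hom (RatFn.toFunctionField x _) = _
  congr 1
  rw [show algebraMap k M.X.functionField c =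
      (M.X.presheaf.germ ⊤ (genericPoint M.X) trivial).hom
        (M.π.appTop.hom ((Scheme.ΓSpecIso (.of k)).inv.hom c)) from
      RingHom.congr_fun (algebraMap_functionField_eq_germ M) c]
  change (M.X.presheaf.germ ⊤ x trivial ≫ M.X.presheaf.stalkSpecializes _).hom _ = _
  rw [TopCat.Presheaf.germ_stalkSpecializes]

/-- `stalkSubring M x ≠ K`-related sanity: `stalkSubring` contains `k`. [folklore] -/
theorem algebraMap_range_le_stalkSubring (M : ProjModel k K) (x : M.X) :
    (algebraMap k K).range ≤ M.stalkSubring x := by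
  rintro _ ⟨c, rfl⟩; exact M.algebraMap_mem_stalkSubring x c

/-! ## Functoriality along morphisms of models -/

/-- **`𝒪_{N,y} → K` extends `𝒪_{M,φ y} → K`** along the stalk map of a morphism of models
`φ : N → M`. [cite: ZariskiSamuel1960, Ch. VI §17] -/
theorem stalkToK_stalkMap {N M : ProjModel k K} (φ : N.Hom M) (y : N.X)
    (t : M.X.presheaf.stalk (φ.f y)) :
    N.stalkToK y ((φ.f.stalkMap y).hom t) = M.stalkToK (φ.f y) t := by
  change N.funFieldIso.hom.hom (RatFn.toFunctionField y (φ.f.stalkMap y t)) =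
    M.funFieldIso.hom.hom (RatFn.toFunctionField (φ.f y) t)
  rw [← RatFn.functionFieldMap_toFunctionField φ.f y t, funFieldIso_hom_functionFieldMap]

/-- Along a morphism of models `φ : N → M`: `𝒪_{M,φ y} ⊆ 𝒪_{N,y}` inside `K`.
[cite: ZariskiSamuel1960, Ch. VI §17] -/
theorem stalkSubring_le_of_hom {N M : ProjModel k K} (φ : N.Hom M) (y : N.X) :
    M.stalkSubring (φ.f y) ≤ N.stalkSubring y := by
  intro z hz
  obtain ⟨t, rfl⟩ := (M.mem_stalkSubring_iff _).mp hz
  exact (N.mem_stalkSubring_iff y).mpr ⟨_, stalkToK_stalkMap φ y t⟩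

/-- **Along a morphism of models `φ : N → M`, `𝒪_{N,y}` dominates `𝒪_{M,φ y}`** (the stalk map
is a local homomorphism). [cite: ZariskiSamuel1960, Ch. VI §17] -/
theorem stalkSubring_dominates_of_hom {N M : ProjModel k K} (φ : N.Hom M) (y : N.X) :
    SubringDominates (M.stalkSubring (φ.f y)) (N.stalkSubring y) := by
  refine ⟨stalkSubring_le_of_hom φ y, fun z hz hzinv => ?_⟩
  obtain ⟨t, rfl⟩ := (M.mem_stalkSubring_iff _).mp hz
  by_cases h0 : M.stalkToK (φ.f y) t = 0
  · rw [h0, inv_zero]; exact Subring.zero_mem _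
  -- `φ^♯ t` is a unit of `𝒪_{N,y}`
  have hu : IsUnit ((φ.f.stalkMap y).hom t) := by
    rw [← N.isUnit_stalkEquiv_iff y, isUnit_subring_iff_inv_mem]
    refine ⟨by rw [coe_stalkEquiv, stalkToK_stalkMap]; exact h0, ?_⟩
    rw [coe_stalkEquiv, stalkToK_stalkMap]
    exact hzinv
  have hut : IsUnit t := (isUnit_map_iff (φ.f.stalkMap y).hom t).mp hu
  obtain ⟨v, hv⟩ := hut
  refine (M.mem_stalkSubring_iff _).mpr ⟨(↑v⁻¹ : M.X.presheaf.stalk (φ.f y)), ?_⟩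
  refine (inv_eq_of_mul_eq_one_right ?_).symm
  rw [← map_mul, ← hv, Units.mul_inv, map_one]

/-- **A local isomorphism of models identifies the local rings inside `K`.**
[cite: ZariskiSamuel1960, Ch. VI §17] -/
theorem stalkSubring_eq_of_isIso_stalkMap {N M : ProjModel k K} (φ : N.Hom M) (y : N.X)
    [IsIso (φ.f.stalkMap y)] : M.stalkSubring (φ.f y) = N.stalkSubring y := by
  refine le_antisymm (stalkSubring_le_of_hom φ y) fun z hz => ?_
  obtain ⟨s, rfl⟩ := (N.mem_stalkSubring_iff y).mp hz
  obtain ⟨t, rfl⟩ : ∃ t, (φ.f.stalkMap y).hom t = s :=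
    ⟨(inv (φ.f.stalkMap y)).hom s, by
      rw [← CommRingCat.comp_apply, IsIso.inv_hom_id, CommRingCat.id_apply]⟩
  rw [stalkToK_stalkMap]
  exact M.stalkToK_mem _ t

/-! ## Centres of local rings of `K` on a model -/

/-- **`x` is a centre of the local ring `𝔬 ⊆ K` on the model `M`**: `𝔬` dominates `𝒪_{M,x}`
(Zariski–Samuel II, Ch. VI §17). [cite: ZariskiSamuel1960, Ch. VI §17] -/
def IsCentreOf (M : ProjModel k K) (O : Subring K) (x : M.X) : Prop :=
  SubringDominates (M.stalkSubring x) O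

/-- **`𝔬` has a centre on `M`.** [cite: ZariskiSamuel1960, Ch. VI §17] -/
def HasCentre (M : ProjModel k K) (O : Subring K) : Prop :=
  ∃ x, M.IsCentreOf O x

/-- Every point is the centre of its own local ring. [folklore] -/
theorem isCentreOf_self (M : ProjModel k K) (x : M.X) : M.IsCentreOf (M.stalkSubring x) x :=
  SubringDominates.refl _

/-- Centres are monotone under domination of the local ring. [folklore] -/
theorem IsCentreOf.mono {M : ProjModel k K} {O O' : Subring K} {x : M.X} (h : M.IsCentreOf O x)
    (h' : SubringDominates O O') : M.IsCentreOf O' x :=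
  SubringDominates.trans h h'

/-- `HasCentre` is monotone under domination. [folklore] -/
theorem HasCentre.mono {M : ProjModel k K} {O O' : Subring K} (h : M.HasCentre O)
    (h' : SubringDominates O O') : M.HasCentre O' := by
  obtain ⟨x, hx⟩ := h; exact ⟨x, hx.mono h'⟩

/-- **Centres are functorial**: along a morphism of models `φ : N → M`, the image of a centre of
`𝔬` on `N` is a centre of `𝔬` on `M`. [cite: ZariskiSamuel1960, Ch. VI §17] -/
theorem IsCentreOf.map {N M : ProjModel k K} (φ : N.Hom M) {O : Subring K} {y : N.X}
    (h : N.IsCentreOf O y) : M.IsCentreOf O (φ.f y) :=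
  (stalkSubring_dominates_of_hom φ y).trans h

/-- `HasCentre` is functorial. [cite: ZariskiSamuel1960, Ch. VI §17] -/
theorem HasCentre.map {N M : ProjModel k K} (φ : N.Hom M) {O : Subring K} (h : N.HasCentre O) :
    M.HasCentre O := by
  obtain ⟨y, hy⟩ := h; exact ⟨φ.f y, hy.map φ⟩

/-- **Centres lift along local isomorphisms**: if `φ : N → M` is a local isomorphism at `y` and
`φ y` is a centre of `𝔬` on `M`, then `y` is a centre of `𝔬` on `N`. [folklore] -/
theorem IsCentreOf.of_isIso_stalkMap {N M : ProjModel k K} (φ : N.Hom M) {O : Subring K} {y : N.X}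
    [IsIso (φ.f.stalkMap y)] (h : M.IsCentreOf O (φ.f y)) : N.IsCentreOf O y := by
  unfold IsCentreOf
  rwa [← stalkSubring_eq_of_isIso_stalkMap φ y]

/-- The structure field lies in a local ring with a centre. [folklore] -/
theorem IsCentreOf.algebraMap_mem {M : ProjModel k K} {O : Subring K} {x : M.X}
    (h : M.IsCentreOf O x) (c : k) : algebraMap k K c ∈ O :=
  h.1 (M.algebraMap_mem_stalkSubring x c)

/-! ## Centres and morphisms `Spec 𝔬 → M` -/

section Lift

variable {M : ProjModel k K} {O : Subring K}

/-- The inclusion `𝔬 ⊆ K` as a morphism `Spec K → Spec 𝔬`. [folklore] -/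
abbrev specKToSubring (O : Subring K) : Spec (CommRingCat.of K) ⟶ Spec (CommRingCat.of O) :=
  Spec.map (CommRingCat.ofHom O.subtype)

/-- **A ring homomorphism `u : 𝒪_{M,x} → K` with `Spec u ≫ (Spec 𝒪_{M,x} → M) = gen_M` IS
`𝒪_{M,x} → K`** (`Spec 𝒪_{M,x} → M` is a monomorphism). [folklore] -/
theorem eq_stalkToK_of_specMap_comp {x : M.X} (u : M.X.presheaf.stalk x →+* K)
    (hu : Spec.map (CommRingCat.ofHom u) ≫ M.X.fromSpecStalk x = M.gen) : u = M.stalkToK x := by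
  have h : Spec.map (CommRingCat.ofHom u) = Spec.map (CommRingCat.ofHom (M.stalkToK x)) := by
    rw [← cancel_mono (M.X.fromSpecStalk x), hu, specMap_stalkToK_fromSpecStalk]
  exact congrArg CommRingCat.Hom.hom (Spec.map_injective h)

/-- **A morphism `l : Spec 𝔬 → M` restricting to `gen_M` on `Spec K` makes `l(𝔪_𝔬)` a centre of
`𝔬`**: the induced local homomorphism `𝒪_{M,l(𝔪)} → 𝔬`, followed by `𝔬 ⊆ K`, is `𝒪_{M,l(𝔪)} → K`.
[cite: ZariskiSamuel1960, Ch. VI §17] -/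
theorem isCentreOf_of_lift [IsLocalRing O] (l : Spec (CommRingCat.of O) ⟶ M.X)
    (hgen : specKToSubring O ≫ l = M.gen) : M.IsCentreOf O (l (closedPoint O)) := by
  set x := l (closedPoint O) with hx
  let φ : M.X.presheaf.stalk x ⟶ CommRingCat.of O := Scheme.stalkClosedPointTo l
  -- `subtype ∘ φ = stalkToK`
  have hφ : O.subtype.comp φ.hom = M.stalkToK x := by
    apply eq_stalkToK_of_specMap_comp
    rw [show CommRingCat.ofHom (O.subtype.comp φ.hom) = φ ≫ CommRingCat.ofHom O.subtype from rfl,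
      Spec.map_comp, Category.assoc, Scheme.Spec_stalkClosedPointTo_fromSpecStalk, hgen]
  have hval : ∀ t, ((φ.hom t : O) : K) = M.stalkToK x t := fun t => RingHom.congr_fun hφ t
  refine ⟨fun z hz => ?_, fun z hz hzinv => ?_⟩
  · obtain ⟨t, rfl⟩ := (M.mem_stalkSubring_iff x).mp hz
    rw [← hval]; exact (φ.hom t).2
  · obtain ⟨t, rfl⟩ := (M.mem_stalkSubring_iff x).mp hz
    by_cases h0 : M.stalkToK x t = 0
    · rw [h0, inv_zero]; exact Subring.zero_mem _
    have hu : IsUnit (φ.hom t) := by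
      rw [isUnit_subring_iff_inv_mem, hval]; exact ⟨h0, hzinv⟩
    obtain ⟨v, hv⟩ := (isUnit_map_iff φ.hom t).mp hu
    refine (M.mem_stalkSubring_iff x).mpr ⟨(↑v⁻¹ : M.X.presheaf.stalk x), ?_⟩
    refine (inv_eq_of_mul_eq_one_right ?_).symm
    rw [← map_mul, ← hv, Units.mul_inv, map_one]

/-- **Conversely, a centre `x` of `𝔬` yields `Spec 𝔬 → Spec 𝒪_{M,x} → M` through `x`,
restricting to `gen_M` on `Spec K`.** [cite: ZariskiSamuel1960, Ch. VI §17] -/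
theorem IsCentreOf.exists_lift [IsLocalRing O] {x : M.X} (h : M.IsCentreOf O x) :
    ∃ l : Spec (CommRingCat.of O) ⟶ M.X, specKToSubring O ≫ l = M.gen ∧ l (closedPoint O) = x := by
  -- `ρ : 𝒪_{M,x} → 𝔬`, a local homomorphism by domination
  let ρ : M.X.presheaf.stalk x →+* O :=
    (M.stalkToK x).codRestrict O (fun t => h.1 (M.stalkToK_mem x t))
  have hρ : ∀ t, ((ρ t : O) : K) = M.stalkToK x t := fun t => rfl
  haveI : IsLocalHom ρ := ⟨fun t ht => by
    rw [isUnit_subring_iff_inv_mem, hρ] at ht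
    have hmem : (M.stalkToK x t)⁻¹ ∈ M.stalkSubring x := h.2 _ (M.stalkToK_mem x t) ht.2
    have hu : IsUnit (M.stalkEquiv x t) := by
      rw [isUnit_subring_iff_inv_mem, coe_stalkEquiv]; exact ⟨ht.1, hmem⟩
    exact (M.isUnit_stalkEquiv_iff x t).mp hu⟩
  haveI : IsLocalHom (CommRingCat.ofHom ρ).hom := inferInstanceAs (IsLocalHom ρ)
  refine ⟨Spec.map (CommRingCat.ofHom ρ) ≫ M.X.fromSpecStalk x, ?_, ?_⟩
  · rw [← Spec.map_comp_assoc]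
    exact M.specMap_stalkToK_fromSpecStalk x
  · rw [Scheme.Hom.comp_apply, Spec_closedPoint, Scheme.fromSpecStalk_closedPoint]

/-- `HasCentre` in morphism form. [cite: ZariskiSamuel1960, Ch. VI §17] -/
theorem hasCentre_iff_exists_lift [IsLocalRing O] :
    M.HasCentre O ↔ ∃ l : Spec (CommRingCat.of O) ⟶ M.X, specKToSubring O ≫ l = M.gen := by
  constructor
  · rintro ⟨x, hx⟩
    obtain ⟨l, hl, -⟩ := hx.exists_lift
    exact ⟨l, hl⟩
  · rintro ⟨l, hl⟩
    exact ⟨_, isCentreOf_of_lift l hl⟩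

end Lift

/-! ## Valuation rings: the two notions of centre agree; uniqueness of centres -/

section Valuation

variable {M : ProjModel k K}

/-- A lift `Spec 𝒪_v → M` restricting to `gen_M` automatically lies over `Spec 𝒪_v → Spec k`.
[folklore] -/
theorem lift_comp_π_eq_specOTo (v : ZariskiRiemannSpace k K)
    (l : Spec (CommRingCat.of v.asValuationSubring) ⟶ M.X) (hl : KModel.specKTo v ≫ l = M.gen) :
    l ≫ M.π = KModel.specOTo v := by
  obtain ⟨χ, hχ⟩ : ∃ χ, Spec.map χ = l ≫ M.π := ⟨_, Spec.map_preimage _⟩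
  rw [← hχ, KModel.specOTo]
  congr 1
  -- both ring maps `k → 𝒪_v` agree after `𝒪_v ⊆ K`
  have h1 : χ ≫ CommRingCat.ofHom (algebraMap v.asValuationSubring K) =
      CommRingCat.ofHom (KModel.toValuationSubringHom v) ≫
        CommRingCat.ofHom (algebraMap v.asValuationSubring K) := by
    apply Spec.map_injective
    rw [Spec.map_comp, Spec.map_comp, hχ, ← Category.assoc]
    change (KModel.specKTo v ≫ l) ≫ M.π = KModel.specKTo v ≫ KModel.specOTo v
    rw [hl, M.gen_π, KModel.specKTo_specOTo]
  haveI : Mono (CommRingCat.ofHom (algebraMap v.asValuationSubring K)) :=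
    ConcreteCategory.mono_of_injective _ Subtype.val_injective
  exact (cancel_mono _).mp h1

/-- **A centre in the sense of domination is a centre in the sense of the valuative square**
(`KModel.IsCentre`). [cite: ZariskiSamuel1960, Ch. VI §17] -/
theorem IsCentreOf.isCentre {v : ZariskiRiemannSpace k K} {x : M.X}
    (h : M.IsCentreOf v.asValuationSubring.toSubring x) : M.toKModel.IsCentre v x := by
  haveI : IsLocalRing v.asValuationSubring.toSubring :=
    inferInstanceAs (IsLocalRing v.asValuationSubring)
  obtain ⟨l, hl, hlx⟩ := h.exists_lift
  exact ⟨l, hl, lift_comp_π_eq_specOTo v l hl, hlx⟩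

/-- **Conversely, a centre in the sense of the valuative square is dominated.**
[cite: ZariskiSamuel1960, Ch. VI §17] -/
theorem isCentreOf_of_isCentre {v : ZariskiRiemannSpace k K} {x : M.X}
    (h : M.toKModel.IsCentre v x) : M.IsCentreOf v.asValuationSubring.toSubring x := by
  haveI : IsLocalRing v.asValuationSubring.toSubring :=
    inferInstanceAs (IsLocalRing v.asValuationSubring)
  obtain ⟨l, hl, -, hlx⟩ := h
  rw [← hlx]
  exact isCentreOf_of_lift (O := v.asValuationSubring.toSubring) l hl

/-- **The centre of a valuation ring `𝒪_v ∈ Zar(K/k)` on a projective model dominates it.**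
[cite: ZariskiSamuel1960, Ch. VI §17] -/
theorem isCentreOf_centre (M : ProjModel k K) (v : ZariskiRiemannSpace k K) :
    M.IsCentreOf v.asValuationSubring.toSubring (M.centre v) :=
  isCentreOf_of_isCentre (M.isCentre_centre v)

/-- Every valuation ring of `K/k` has a centre on a projective model. [cite: ZariskiSamuel1960, Ch. VI §17] -/
theorem hasCentre_valuationSubring (M : ProjModel k K) (v : ZariskiRiemannSpace k K) :
    M.HasCentre v.asValuationSubring.toSubring :=
  ⟨_, M.isCentreOf_centre v⟩

/-- **Uniqueness of the centre** of a local ring `𝔬` of `K` on a projective model (Zariski–Samuel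
II, Ch. VI §17): dominate `𝔬` by a valuation ring (Chevalley) and use the valuative criterion of
separatedness. [cite: ZariskiSamuel1960, Ch. VI §17] -/
theorem IsCentreOf.unique {O : Subring K} [IsLocalRing O] {x y : M.X} (hx : M.IsCentreOf O x)
    (hy : M.IsCentreOf O y) : x = y := by
  obtain ⟨V, hV⟩ := (LocalSubring.mk O).exists_le_valuationSubring
  haveI : IsLocalRing V.toSubring := inferInstanceAs (IsLocalRing V)
  have hOV : SubringDominates O V.toSubring := (subringDominates_iff O V.toSubring).mpr hV
  let v : ZariskiRiemannSpace k K := ⟨V, fun c => hOV.1 (hx.algebraMap_mem c)⟩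
  have hx' : M.toKModel.IsCentre v x := (hx.mono hOV).isCentre (v := v)
  have hy' : M.toKModel.IsCentre v y := (hy.mono hOV).isCentre (v := v)
  exact hx'.unique hy'

/-- The centre of a local ring dominated by `𝒪_v` is the centre of `v`. [folklore] -/
theorem IsCentreOf.eq_centre {O : Subring K} {x : M.X} (hx : M.IsCentreOf O x)
    (v : ZariskiRiemannSpace k K) (hOv : SubringDominates O v.asValuationSubring.toSubring) :
    x = M.centre v := by
  haveI : IsLocalRing v.asValuationSubring.toSubring :=
    inferInstanceAs (IsLocalRing v.asValuationSubring)
  exact (hx.mono hOv).unique (M.isCentreOf_centre v)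

/-- **Along a morphism of models, a centre upstairs maps to THE centre downstairs.**
[cite: ZariskiSamuel1960, Ch. VI §17] -/
theorem IsCentreOf.eq_map {N M : ProjModel k K} (φ : N.Hom M) {O : Subring K} [IsLocalRing O]
    {y : N.X} {x : M.X} (hy : N.IsCentreOf O y) (hx : M.IsCentreOf O x) : x = φ.f y :=
  hx.unique (hy.map φ)

end Valuation

/-! ## The generic point -/

/-- The generic point is a centre of every local ring of `K` containing some local ring of `M`… in
particular of `K` itself: `stalkSubring M ξ = K`. [folklore] -/
theorem stalkSubring_genericPoint (M : ProjModel k K) : M.stalkSubring (genericPoint M.X) = ⊤ := by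
  refine eq_top_iff.mpr fun z _ => (M.mem_stalkSubring_iff _).mpr ?_
  refine ⟨M.funFieldIso.inv.hom z, ?_⟩
  change M.funFieldIso.hom.hom (RatFn.toFunctionField (genericPoint M.X) (M.funFieldIso.inv.hom z)) = z
  have h1 : RatFn.toFunctionField (genericPoint M.X) = RingHom.id _ := by
    change (M.X.presheaf.stalkSpecializes _).hom = _
    rw [TopCat.Presheaf.stalkSpecializes_refl]
    rfl
  rw [h1, RingHom.id_apply, ← CommRingCat.comp_apply, Iso.inv_hom_id, CommRingCat.id_apply]

/-- `K` (the trivial local ring of `K`) has the generic point as centre. [folklore] -/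
theorem isCentreOf_top_genericPoint (M : ProjModel k K) : M.IsCentreOf ⊤ (genericPoint M.X) := by
  unfold IsCentreOf
  rw [stalkSubring_genericPoint]
  exact SubringDominates.refl _

/-! ## Centres on the join -/

section Join

variable {M₁ M₂ : ProjModel k K} {O : Subring K}

/-- Two lifts `Spec 𝔬 → M₁`, `Spec 𝔬 → M₂` restricting to the `K`-points induce the same
`k`-structure on `Spec 𝔬` (both are `Spec` of ring maps `k → 𝔬` which agree in `K`). [folklore] -/
theorem lift_comp_π_eq [IsLocalRing O] (l₁ : Spec (CommRingCat.of O) ⟶ M₁.X)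
    (hl₁ : specKToSubring O ≫ l₁ = M₁.gen) (l₂ : Spec (CommRingCat.of O) ⟶ M₂.X)
    (hl₂ : specKToSubring O ≫ l₂ = M₂.gen) : l₂ ≫ M₂.π = l₁ ≫ M₁.π := by
  obtain ⟨χ₁, hχ₁⟩ : ∃ χ, Spec.map χ = l₁ ≫ M₁.π := ⟨_, Spec.map_preimage _⟩
  obtain ⟨χ₂, hχ₂⟩ : ∃ χ, Spec.map χ = l₂ ≫ M₂.π := ⟨_, Spec.map_preimage _⟩
  rw [← hχ₁, ← hχ₂]
  congr 1
  haveI : Mono (CommRingCat.ofHom O.subtype) :=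
    ConcreteCategory.mono_of_injective _ Subtype.val_injective
  rw [← cancel_mono (CommRingCat.ofHom O.subtype)]
  apply Spec.map_injective
  rw [Spec.map_comp, Spec.map_comp, hχ₁, hχ₂, ← Category.assoc, ← Category.assoc]
  change (specKToSubring O ≫ l₂) ≫ M₂.π = (specKToSubring O ≫ l₁) ≫ M₁.π
  rw [hl₁, hl₂, M₁.gen_π, M₂.gen_π]

omit [Algebra k K] in
/-- The image of `Spec K → Spec 𝔬` is dense (`𝔬 ⊆ K`): every point of `Spec 𝔬` specialises from
the image of `Spec K`. [folklore] -/
theorem mem_closure_specKToSubring (p : Spec (CommRingCat.of O)) :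
    p ∈ closure ({specKToSubring O (closedPoint K)} : Set (Spec (CommRingCat.of O))) := by
  have hdense : DenseRange (PrimeSpectrum.comap (CommRingCat.ofHom O.subtype).hom) := by
    rw [PrimeSpectrum.denseRange_comap_iff_ker_le_nilRadical,
      show RingHom.ker (CommRingCat.ofHom O.subtype).hom = ⊥ from
        (RingHom.injective_iff_ker_eq_bot _).mp Subtype.val_injective]
    exact bot_le
  have hsub : Set.range (PrimeSpectrum.comap (CommRingCat.ofHom O.subtype).hom) ⊆
      {specKToSubring O (closedPoint K)} := by
    rintro _ ⟨p', rfl⟩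
    obtain rfl : p' = closedPoint K := eq_closedPoint_of_field p'
    rfl
  exact closure_mono hsub (hdense p)

omit [Algebra k K] in
/-- A morphism `g : Spec 𝔬 → Z` sending the image of `Spec K` to the point `rl(pt)` of a `K`-point
`rl` of `Z` lands in the scheme-theoretic image of `rl`. [folklore] -/
theorem range_subset_range_imageι {Z : Scheme.{u}} (rl : Spec (CommRingCat.of K) ⟶ Z)
    (g : Spec (CommRingCat.of O) ⟶ Z) (hg : specKToSubring O ≫ g = rl) :
    Set.range g ⊆ Set.range rl.imageι := by
  rw [Scheme.IdealSheafData.range_subschemeι, Scheme.Hom.support_ker]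
  rintro _ ⟨p, rfl⟩
  have h1 : g p ∈ closure (g '' {specKToSubring O (closedPoint K)}) :=
    map_mem_closure g.continuous (mem_closure_specKToSubring p) fun x hx => Set.mem_image_of_mem g hx
  rw [Set.image_singleton, ← Scheme.Hom.comp_apply, hg] at h1
  have hmem : rl (closedPoint K) ∈ Set.range rl := ⟨_, rfl⟩
  exact closure_mono (Set.singleton_subset_iff.mpr hmem) h1

end Join

section Closure

variable (M : ProjModel k K) {Q : Motives.SchemeOver k} (hQ : Motives.IsProjectiveOver Q)
  (rl : Spec (CommRingCat.of K) ⟶ Q.left) (s : Q.left ⟶ M.X) (hs : s ≫ M.π = Q.hom)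
  (hr : rl ≫ s = M.gen)

/-- **Lifting `Spec 𝔬 → Q` to the closure model of a `K`-point `rl` of `Q`**: a morphism
`g : Spec 𝔬 → Q` with `Spec K → Spec 𝔬 → Q = rl` factors through the scheme-theoretic image of
`rl` (`Spec 𝔬` is reduced, and its image lies in the closure of `rl`), compatibly with the
`K`-points. [cite: ZariskiSamuel1960, Ch. VI §17] -/
theorem ofClosure.exists_lift {O : Subring K} (g : Spec (CommRingCat.of O) ⟶ Q.left)
    (hg : specKToSubring O ≫ g = rl) :
    ∃ h : Spec (CommRingCat.of O) ⟶ (ofClosure M hQ rl s hs hr).X,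
      specKToSubring O ≫ h = (ofClosure M hQ rl s hs hr).gen ∧ h ≫ rl.imageι = g := by
  have hrange : Set.range g ⊆ Set.range rl.imageι := range_subset_range_imageι rl g hg
  let h : Spec (CommRingCat.of O) ⟶ rl.image := IsClosedImmersion.liftOfRange rl.imageι g hrange
  have hhι : h ≫ rl.imageι = g := IsClosedImmersion.liftOfRange_fac _ _ _
  refine ⟨h, ?_, hhι⟩
  change specKToSubring O ≫ h = rl.toImage
  rw [← cancel_mono rl.imageι, Category.assoc, hhι, hg, Scheme.Hom.toImage_imageι]

end Closure

section Join

variable {M₁ M₂ : ProjModel k K} {O : Subring K}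

/-- **A local ring of `K` with centres on `M₁` and on `M₂` has a centre on the join `J(M₁, M₂)`**,
mapping to the given centres (Zariski–Samuel II, Ch. VI §17: the join of two models; Piltant
2013, Lemma 3.3): `Spec 𝔬 → M₁ ×ₖ M₂` lands in the closure of the diagonal `K`-point because
`Spec 𝔬` is reduced and irreducible with generic point `Spec K`. [cite: ZariskiSamuel1960, Ch. VI §17] -/
theorem exists_isCentreOf_join [IsLocalRing O] {x₁ : M₁.X} {x₂ : M₂.X}
    (h₁ : M₁.IsCentreOf O x₁) (h₂ : M₂.IsCentreOf O x₂) :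
    ∃ j : (join M₁ M₂).X, (join M₁ M₂).IsCentreOf O j ∧
      (joinFst M₁ M₂).f j = x₁ ∧ (joinSnd M₁ M₂).f j = x₂ := by
  obtain ⟨l₁, hl₁, hl₁x⟩ := h₁.exists_lift
  obtain ⟨l₂, hl₂, hl₂x⟩ := h₂.exists_lift
  have hv₂ : l₂ ≫ M₂.π = l₁ ≫ M₁.π := lift_comp_π_eq l₁ hl₁ l₂ hl₂
  let f : Spec (CommRingCat.of O) ⟶ (joinAmbient M₁ M₂).left :=
    (liftToJoinAmbient (l₁ ≫ M₁.π) l₁ l₂ rfl hv₂).left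
  have hf₁ : f ≫ joinAmbientFst M₁ M₂ = l₁ := liftToJoinAmbient_fst _ _ _ _ _
  have hf₂ : f ≫ joinAmbientSnd M₁ M₂ = l₂ := liftToJoinAmbient_snd _ _ _ _ _
  have hsf : specKToSubring O ≫ f = joinPoint M₁ M₂ :=
    comp_left_eq_joinPoint _ _ _ _ _ (specKToSubring O) hl₁ hl₂
  obtain ⟨h, hgenh, hhι⟩ : ∃ h : Spec (CommRingCat.of O) ⟶ (join M₁ M₂).X,
      specKToSubring O ≫ h = (join M₁ M₂).gen ∧ h ≫ (joinPoint M₁ M₂).imageι = f :=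
    ofClosure.exists_lift M₁ (isProjectiveOver_joinAmbient M₁ M₂) (joinPoint M₁ M₂)
      (joinAmbientFst M₁ M₂) (joinAmbientFst_π M₁ M₂) (joinPoint_fst M₁ M₂) f hsf
  refine ⟨h (closedPoint O), isCentreOf_of_lift h hgenh, ?_, ?_⟩
  · rw [← hl₁x, ← hf₁, ← hhι, Category.assoc]
    rfl
  · rw [← hl₂x, ← hf₂, ← hhι, Category.assoc]
    rfl

/-- **`HasCentre` on the join.** [cite: ZariskiSamuel1960, Ch. VI §17] -/
theorem hasCentre_join [IsLocalRing O] (h₁ : M₁.HasCentre O) (h₂ : M₂.HasCentre O) :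
    (join M₁ M₂).HasCentre O := by
  obtain ⟨x₁, hx₁⟩ := h₁
  obtain ⟨x₂, hx₂⟩ := h₂
  obtain ⟨j, hj, -, -⟩ := exists_isCentreOf_join hx₁ hx₂
  exact ⟨j, hj⟩

/-- Conversely a centre on the join gives centres on both factors. [folklore] -/
theorem hasCentre_join_iff [IsLocalRing O] :
    (join M₁ M₂).HasCentre O ↔ M₁.HasCentre O ∧ M₂.HasCentre O :=
  ⟨fun h => ⟨h.map (joinFst M₁ M₂), h.map (joinSnd M₁ M₂)⟩, fun h => hasCentre_join h.1 h.2⟩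

end Join

end ProjModel

end Literature.AlgebraicGeometry.Resolution

end
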